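import Literature.NumberTheory.Automorphic.ArchCoefficientModule
import Literature.NumberTheory.Automorphic.AutomorphicRepCohomologyCoeff
import Literature.NumberTheory.Automorphic.AutomorphicRepLieActionGL
import Literature.NumberTheory.Automorphic.AutomorphyDatumGLRegular
import HarnessLib

/-!
# `H^q(𝔤, K_∞; π ⊗ E_wt(ℂ))` for cuspidal automorphic representations of `GL_n / F`

Topic `NumberTheory/Automorphic`; namespace
`Literature.NumberTheory.Automorphic.CuspidalAutomorphicRepData`.  Definitions with bodies and
theorems; no named fact, no instance, no `sorry`.

The automorphic side of the Eichler–Shimura–Harder description of the cuspidal (= interior, for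
`GL₂` over an imaginary quadratic field) cohomology of arithmetic quotients of `GL_n / F`,
`H^q_cusp(X_U, Ṽ_wt) = ⊕_π H^q(𝔤, K_∞; π_∞ ⊗ E_wt) ⊗ π_f^{U}` [cite: Harder1987, §3.1–3.2]
[cite: BorelWallach2000, VII §2, §5–6]: for a cuspidal automorphic representation
`π : CuspidalAutomorphicRepData n F hcpt` (the tree's data: forms `π.W`, `(𝔤, K_∞)`-module
`kRep`/`lieRep`, finite-adelic action `finiteRep`) and a weight `wt`,

* `π.cohomologyWt wt q = H^q(𝔤, K_∞; π ⊗ E_wt(ℂ))` — the tree's `gkCohomologyWith`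
  (`AutomorphicRepCohomologyCoeff`) at the archimedean coefficient module
  `ParallelWeight.archCoeffRep F n wt` (`ArchCoefficientModule`, a `(𝔤, K_∞)`-module by
  `isGKModule_archCoeff`), the datum being regular (`AutomorphyDatum.isRegular_gl`) and the Lie
  action `π.1.lieRep` (`hasLieAction_lieRep`);
* `π.cohomologyWtRep wt q` — **the representation of `GL_n(𝔸_F^∞)` on it** (`cohomologyRepWith`
  transported along `GLn.ofFinite`), and `cohomologyWtRep_isSmooth` — **it is smooth**;
* `π.cohomologyWtLevel wt U q = H^q(𝔤, K_∞; π ⊗ E_wt(ℂ))^U`, the Hecke operators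
  `π.heckeOpWt wt U q g = [U g U]` (the tree's `heckeOperator`) and
  **`π.heckeTWt wt U q w j = T_{w,j}`** with the SAME elements `BigHeckeGLn.heckeElement n F w j` as
  the Betti-side `ParallelWeight.heckeT`; `heckeOpWt_apply_mem` / `heckeOpWtLevel` — for `U`
  compact open they preserve the `U`-invariants (`isHeckeTriple_top_of_isCompact_isOpen`,
  `finite_orbit_quotient`, `heckeOperator_apply_mem_fixedPoints`).

What is NOT here (no carrier in the tree): the comparison map from `⊕_π H^q(𝔤, K_∞; π ⊗ E_wt)^U`
to `ParallelWeight.cohomology ℂ F n wt U q` (de Rham, Borel's regularization) and its image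
`H_cusp ⊇ H_!` [cite: Harder1987, §3.2].

## Mathlib / Literature search

Tree: `AutomorphicRepData.gkCohomologyWith/cohomologyRepWith/cohomologyRepWith_isSmooth`,
`ParallelWeight.archCoeffRep/archCoeffLie/isGKModule_archCoeff`, `AutomorphyDatum.isRegular_gl`,
`AutomorphicRepData.lieRep/hasLieAction_lieRep`, `heckeOperator`,
`heckeOperator_apply_mem_fixedPoints`, `GLn.continuous_ofFinite`.
`lean search 'cohomologyWt|heckeTWt'`: nothing prior.

## References

* G. Harder, Invent. Math. 89 (1987), §3.1–3.2 [Harder1987].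
* A. Borel, N. Wallach (2000), VII §2, §5–6 (held) [BorelWallach2000].
* A. Borel, H. Jacquet (1979), 4.6 [BorelJacquet1979].
-/

noncomputable section

namespace Literature.NumberTheory.Automorphic

open scoped TensorProduct

-- Mathlib idiom (as in `GKModules`): commutator bracket on `Module.End`
attribute [local instance 100] LieRing.ofAssociativeRing

namespace CuspidalAutomorphicRepData

open RealMatrixGroup ParallelWeight
open scoped MatrixGroups Classical

variable {F : Type} [Field F] [NumberField F] {n : ℕ} {hcpt : isCompact_glFiniteIntegralLevel n F}
  (π : CuspidalAutomorphicRepData n F hcpt) (wt : Fin n → ℤ)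

/-- **`H^q(𝔤, K_∞; π ⊗ E_wt(ℂ))`** — the relative Lie algebra cohomology of the cuspidal
automorphic representation `π` of `GL_n(𝔸_F)` (its `(𝔤, K_∞)`-module of `K_∞`-finite vectors,
`AutomorphicRepData.kRep` / `lieRep`) with coefficients in the archimedean coefficient module
`E_wt(ℂ)` (`ParallelWeight.archCoeffRep`). [cite: BorelWallach2000, VII §2, §5] -/
abbrev cohomologyWt (q : ℕ) : Type _ :=
  π.1.gkCohomologyWith (restrictK (archGroupGL n F) (archCoeffRep F n wt)) (archCoeffLie F n wt)
    (isGKModule_archCoeff F n wt).ad_compat (AutomorphyDatum.isRegular_gl hcpt)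
    π.1.hasLieAction_lieRep q

/-- The action of `G(𝔸_f) = range GLn.ofFinite` on `H^q(𝔤, K_∞; π ⊗ E_wt(ℂ))` (by `π_f ⊗ 1` on
cochains). [cite: BorelJacquet1979, 4.6] -/
def cohomologyWtRepRange (q : ℕ) :
    Representation ℂ (AutomorphyDatum.gl n F hcpt).finiteAdelic (π.cohomologyWt wt q) :=
  π.1.cohomologyRepWith (restrictK (archGroupGL n F) (archCoeffRep F n wt)) (archCoeffLie F n wt)
    (isGKModule_archCoeff F n wt).ad_compat (AutomorphyDatum.isRegular_gl hcpt)
    π.1.hasLieAction_lieRep q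

/-- **The representation of `GL_n(𝔸_F^∞)` on `H^q(𝔤, K_∞; π ⊗ E_wt(ℂ))`** (transported along
`GLn.ofFinite : GL_n(𝔸_F^∞) → G(𝔸_f)`). [cite: BorelJacquet1979, 4.6] -/
def cohomologyWtRep (q : ℕ) :
    Representation ℂ (BigHeckeGLn.FiniteAdelicGL n F) (π.cohomologyWt wt q) :=
  (π.cohomologyWtRepRange wt q).comp (GLn.ofFinite n F).rangeRestrict

/-- Unfolding. [folklore] -/
theorem cohomologyWtRep_apply (q : ℕ) (g : BigHeckeGLn.FiniteAdelicGL n F) :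
    π.cohomologyWtRep wt q g =
      π.cohomologyWtRepRange wt q ⟨GLn.ofFinite n F g, g, rfl⟩ :=
  rfl

/-- **The `GL_n(𝔸_F^∞)`-action on `H^q(𝔤, K_∞; π ⊗ E_wt(ℂ))` is smooth.**
[cite: BorelJacquet1979, 4.6 with 4.3] -/
theorem cohomologyWtRep_isSmooth (q : ℕ) : (π.cohomologyWtRep wt q).IsSmooth := by
  intro x
  have h := π.1.cohomologyRepWith_isSmooth (restrictK (archGroupGL n F) (archCoeffRep F n wt))
    (archCoeffLie F n wt) (isGKModule_archCoeff F n wt).ad_compat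
    (AutomorphyDatum.isRegular_gl hcpt) π.1.hasLieAction_lieRep q x
  have hc : Continuous (GLn.ofFinite n F).rangeRestrict :=
    (GLn.continuous_ofFinite n F).subtype_mk _
  have e : ((π.cohomologyWtRep wt q).stabilizerSubgroup x :
      Set (BigHeckeGLn.FiniteAdelicGL n F)) =
      (fun g => (GLn.ofFinite n F).rangeRestrict g) ⁻¹'
        (((π.cohomologyWtRepRange wt q).stabilizerSubgroup x :
            Subgroup (AutomorphyDatum.gl n F hcpt).finiteAdelic) :
          Set (AutomorphyDatum.gl n F hcpt).finiteAdelic) := by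
    ext g
    simp only [SetLike.mem_coe, Representation.mem_stabilizerSubgroup, Set.mem_preimage]
    rfl
  change IsOpen ((π.cohomologyWtRep wt q).stabilizerSubgroup x :
    Set (BigHeckeGLn.FiniteAdelicGL n F))
  rw [e]
  exact h.preimage hc

/-! #### Level `U`: the Hecke module `H^q(𝔤, K_∞; π ⊗ E_wt(ℂ))^U` -/

variable (U : Subgroup (BigHeckeGLn.FiniteAdelicGL n F))

/-- **`H^q(𝔤, K_∞; π ⊗ E_wt(ℂ))^U`**: the `U`-invariants, for a level
`U ≤ GL_n(𝔸_F^∞)`. [cite: Harder1987, §3.1] -/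
abbrev cohomologyWtLevel (q : ℕ) : Submodule ℂ (π.cohomologyWt wt q) :=
  (π.cohomologyWtRep wt q).fixedPoints U

/-- The Hecke operator `[U g U] = ∑_{yU ⊆ UgU} y` on `H^q(𝔤, K_∞; π ⊗ E_wt(ℂ))`
(the tree's `heckeOperator`). [folklore] -/
abbrev heckeOpWt (q : ℕ) (g : BigHeckeGLn.FiniteAdelicGL n F) :
    Module.End ℂ (π.cohomologyWt wt q) :=
  heckeOperator (π.cohomologyWtRep wt q) U g

/-- **`T_{w,j} = [U t_{w,j} U]`** on `H^q(𝔤, K_∞; π ⊗ E_wt(ℂ))`, with the same elements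
`t_{w,j} = BigHeckeGLn.heckeElement n F w j` as the Betti-side `ParallelWeight.heckeT`.
[cite: Harder1987, §3.1] -/
abbrev heckeTWt (q : ℕ)
    (w : IsDedekindDomain.HeightOneSpectrum (_root_.NumberField.RingOfIntegers F)) (j : ℕ) :
    Module.End ℂ (π.cohomologyWt wt q) :=
  π.heckeOpWt wt U q (BigHeckeGLn.heckeElement n F w j)

/-- For `U` compact open the Hecke operators preserve the `U`-invariants. [folklore] -/
theorem heckeOpWt_apply_mem (hUo : IsOpen (U : Set (BigHeckeGLn.FiniteAdelicGL n F)))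
    (hUc : IsCompact (U : Set (BigHeckeGLn.FiniteAdelicGL n F))) (q : ℕ)
    (g : BigHeckeGLn.FiniteAdelicGL n F) {v : π.cohomologyWt wt q}
    (hv : v ∈ π.cohomologyWtLevel wt U q) :
    π.heckeOpWt wt U q g v ∈ π.cohomologyWtLevel wt U q := by
  haveI := isHeckeTriple_top_of_isCompact_isOpen U hUc hUo
  exact heckeOperator_apply_mem_fixedPoints _ U g hv (finite_orbit_quotient U g)

/-- **The Hecke operator `[U g U]` on the level-`U` piece `H^q(𝔤, K_∞; π ⊗ E_wt(ℂ))^U`**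
(`U` compact open). [folklore] -/
def heckeOpWtLevel (hUo : IsOpen (U : Set (BigHeckeGLn.FiniteAdelicGL n F)))
    (hUc : IsCompact (U : Set (BigHeckeGLn.FiniteAdelicGL n F))) (q : ℕ)
    (g : BigHeckeGLn.FiniteAdelicGL n F) : Module.End ℂ (π.cohomologyWtLevel wt U q) :=
  (π.heckeOpWt wt U q g).restrict fun _ hv => π.heckeOpWt_apply_mem wt U hUo hUc q g hv

/-- Unfolding. [folklore] -/
@[simp] theorem coe_heckeOpWtLevel_apply (hUo : IsOpen (U : Set (BigHeckeGLn.FiniteAdelicGL n F)))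
    (hUc : IsCompact (U : Set (BigHeckeGLn.FiniteAdelicGL n F))) (q : ℕ)
    (g : BigHeckeGLn.FiniteAdelicGL n F) (v : π.cohomologyWtLevel wt U q) :
    (π.heckeOpWtLevel wt U hUo hUc q g v : π.cohomologyWt wt q) = π.heckeOpWt wt U q g v :=
  rfl

end CuspidalAutomorphicRepData

end Literature.NumberTheory.Automorphic
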